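import Mathlib
import HarnessLib
import HarnessLib.Audit
import Summits.QuantumFields.Statement

/-!
Route: ModularSelfDualFold

DORMANT since 2026-09-03T09:43:11Z (reconciler: no traction for 5 d (last activity statement-checked at 2026-08-29T08:51:46Z); parked, not closed — `ledger route dormant route-QuantumFields-ModularSelfDualFold --off` to reactivate) — unstaffed, not closed; items shared with open routes are served there. `ledger route dormant <id> --off` reactivates.

# Route ModularSelfDualFold — Fold the coupling axis — level-k modular truncation makes 4D lattice
Yang–Mills Kramers–Wannier self-dual; weak-coupling lattice gap = no self-dual massless phase, then
k → ∞

It suffices to show X = (L) ∧ (C). (L) WeakCouplingLatticeGap: for every compact simple G and every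
faithful unitary lattice
representation r there is β₁ such that at EVERY bare coupling β ≥ β₁ Wilson's four-dimensional
lattice G-gauge theory on the
periodic tori (ℤ/(2S+1))⁴ clusters exponentially in Euclidean time for all gauge-invariant local
observables,
|⟨A·τₙB⟩ − ⟨A⟩⟨B⟩| ≤ C(A,B) e^{−m(β) n} with m(β) > 0, uniformly in the volume (the statement's
HasLatticeMassGap idiom at fixed β)
— the lattice half of Clay, to be reached by the card's modular fold: regularise Rep(G) by the
modular categories C(g,k), prove
Kramers–Wannier SELF-DUALITY of the level-k model (kernel = modular S-matrix; item
ModularSelfDuality), exclude a self-dual massless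
phase at the fold (item NoSelfDualMasslessBand; both filed informal right after open, until the
level-k vocabulary lands), obtain a
k-uniform gap below the fold and let k → ∞ onto Wilson's transfer matrix. (C) GapToContinuum, the
imported complement: lattice
massiveness at all large β ⇒ the Clay data (OS limit along a sequential scheme, non-trivial,
non-Gaussian, gapped, with the lattice
gap at the scheme's scale) for the same G, r. Card realised: modular-selfdual-fold (spine, sole
card).
Lean: `WeakCouplingLatticeGap ∧ GapToContinuum`

## Assembly
Pure logic (sorry-free in Sketch.lean, theorem assembly_holds, axioms {propext, Classical.choice,
Quot.sound}): fix G with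
IsCompactSimpleLieGroup G, put the Borel σ-algebra on G exactly as the statement does (letI := borel
G), take r from
Nonempty (LatticeRep G), and feed WeakCouplingLatticeGap G r into GapToContinuum G r; the result is
the body of YangMills for G.

Rationale: WHY THIS LINE. Mechanism (card modular-selfdual-fold): the one structure pure Yang–Mills lacks, an
exact electric–magnetic duality, is manufactured
by the regularisation — truncating Rep(G) to the MODULAR category C(g,k) (Deligne: the only finite
symmetric truncations are finite
subgroups, which freeze, barrier ZnHiggsPhaseD4) gives a lattice model whose labels and fluxes both
range over C(g,k), whose β = ∞
corner is the invertible, confined Crane–Yetter/Walker–Wang phase (arXiv:1208.5128 §6,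
arXiv:hep-th/9409167) instead of a deconfined
Dijkgraaf–Witten/Higgs corner, and whose Kramers–Wannier transform has the modular S-matrix as
Fourier kernel (arXiv:1701.02037:
dual spin-network bases on the 1-skeleton and the dual 1-skeleton of T³, identical electric/magnetic
loop spectra); the abelian
prototype is ℤ_N gauge theory, exactly self-dual in d = 4 (KramersWannier1941,
doi:10.1063/1.1665530, doi:10.1103/physrevd.11.2098,
arXiv:1303.0851 §3.3). The coupling axis then folds at β_sd(k) ≈ 0.9(k+2) → ∞ and "lattice mass gap
at every large β" becomes
"no self-dual MASSLESS phase at the fold, k-uniformly" — provably false for U(1), whose fold lies in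
Guth's Coulomb band (Guth1980,
FrohlichSpencerCMP1982, arXiv:1405.2988), conjectured for simple G. Imported areas: modular tensor
categories and 3+1D TQFT (quantum
topology); topological-order stability (BravyiHastingsMichalakis2010, MichalakisZwolakCMP2013; tree
HasLTQO/HasLocalGap) for the
Crane–Yetter corner; the Osterwalder–Seiler cluster expansion for the electric corner (tree, PROVED:
osterwalder_seiler_torusClustering,
osterwalderSeiler_clustering_supNorm_holds); duality defects of 4D gauge theories at self-dual
points (doi:10.1093/ptep/ptab145,
arXiv:2111.01139, arXiv:2111.01141) for the fold trichotomy. No route exists on YangMills before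
this one and the negatives index is
empty; what the typed skeleton adds to the card: the summit is Euclidean/Wilson, so the fold's
deliverable is pinned as (L) in the
statement's own clustering idiom (uniform constants, large β only — bulk first-order points at
intermediate β are not claimed) and
the continuum half is isolated as (C) with its scale problem stated rather than assumed.

RANKED CRUXES. #0 Target (target) — X = WeakCouplingLatticeGap ∧ GapToContinuum (the two typed
cruxes below). (why it might fail: (L) is the 4D weak-coupling lattice mass-gap problem (nothing
rigorous excludes a non-abelian Coulomb phase); (C) carries asymptotic scaling and non-triviality of
the continuum limit; the modular engine ModularSelfDuality may already fail at k = 2 under exact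
diagonalisation.) [arXiv:1803.01950, JaffeWitten2000, arXiv:1701.02037, arXiv:1303.0851]
#2 WeakCouplingLatticeGap (crux) — (L), card K3's k → ∞ output and the parent of the foreseen
modular split: for every compact simple G (IsCompactSimpleLieGroup) and every r : LatticeRep G there
are β₁ and a rate function m with m(β) > 0 for β ≥ β₁ such that for all gauge-invariant local
lattice observables A, B (YMSpecies G) there are C and S₀ with |latticeConnectedCorr r.ρ β (2S+1) A
B n| ≤ C·exp(−m(β)·n) for all β ≥ β₁, all torus half-sides S ≥ S₀ and all time separations n ≤ S —
Wilson's 4D theory is massive at every large bare coupling, uniformly in the volume, with a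
prefactor uniform in β (the shape HasLatticeMassGap demands along any scheme β_k → ∞). [difficulty:
open-problem] (why it might fail: It is Chatterjee's Problem 5.1 at large β: a weak-coupling
massless phase of 4D SU(N) is excluded only by numerics; the fold relocates the hard region (1 < τ <
Ck², ξ ~ e^{cβ}) rather than shrinking it; C uniform in β and S needs locality, not only a gap.)
[arXiv:1803.01950, arXiv:2006.16229, OsterwalderSeilerAnnPhys1978, arXiv:1303.0851,
doi:10.1103/physrevd.21.1013, arXiv:2304.02527]
#3 GapToContinuum (crux) — (C), the imported complement, pointwise in (G, r): for every compact
simple G and every r : LatticeRep G, IF the clustering conclusion of WeakCouplingLatticeGap holds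
for (G, r) THEN there are a sequential scheme sch (a_k → 0, β_k, L_k, renormalisations) and OS data
T for all gauge-invariant species with IsYangMillsFor r sch T, T non-trivial and non-Gaussian in the
curvature species r.curvature, and Δ > 0 with T.HasMassGap Δ ∧ HasLatticeMassGap r sch Δ — the
UV/continuum half (uniform lattice massiveness in, Clay data out), owned by the Balaban-RG /
flow-line / renormalised-trajectory cards and attachable by their routes. [deps:
WeakCouplingLatticeGap] [difficulty: open-problem] (why it might fail: Massiveness in lattice units
carries no scale: the scheme needs a_k ≍ m(β_k) with asymptotic scaling and a non-Gaussian limit,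
else ultralocality/triviality (FixedCouplingUltralocality); no 4D construction with non-trivial
Wilson loops exists yet (Chatterjee 2019 §6).) [Balaban1987RG1, Balaban1989LargeFieldII,
MagnenRivasseauSeneor1993, arXiv:1803.01950, JaffeWitten2000]
#9 Z2TorusFreeEnergySelfDuality (support) — abelian Euclidean prototype of ModularSelfDuality (level
"k = 1", provable now; rev 2: replaces the dropped box form Z2FreeEnergySelfDuality,
stmt-QuantumFields-8903, whose freeEnergyPerSite/znRep vocabulary imported Sweep1 +
Barriers.DiscreteSubgroupFreezing and their unproved cone facts): four-dimensional ℤ₂ lattice gauge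
theory (gauge group Multiplicative (ZMod 2) with the Borel σ-algebra supplied inline as the
Statement does, representation z2Rep, Wilson action Σ_p (1 − σ_p), Haar = uniform) on the periodic
tori (ℤ/(L+1))⁴ is Kramers–Wannier self-dual in free-energy form — with β* = −½ log tanh β (sinh 2β
· sinh 2β* = 1), (L+1)⁻⁴ · [log Z_{L+1}(β) − log Z_{L+1}(β*)] → 3 log(2 cosh² β) − 6β for every β >
0, Z = torusLogPartition 4 z2Rep (LatticeGaugeDLR, log of the Haar-normalised torus partition
function); both sides vanish at the self-dual point β_c = ½ log(1+√2) ≈ 0.4407. Proof: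
high-temperature expansion (mod-2 plaquette 2-cycles, weight tanh β) against low-temperature
expansion (2-coboundaries, weight e^{−2β*} = tanh β), cell duality of the self-dual cubical 4-torus,
and o(L⁴) bounds on the (co)homology sector sums (|H¹(T⁴;ℤ₂)| = 2⁴, |H₂| = 2⁶); constant re-derived
independently by grounder g15-33 and refuters rreview-0815T13-6-g2/g3 (known in print modulo
normalisation: Creutz Ch. 16 (16.22)/(16.36)/(16.37), Wegner 1971, BDI 1975). [difficulty: M]
[doi:10.1063/1.1665530, doi:10.1103/physrevd.11.2098, doi:10.1103/physrevd.20.1915,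
KramersWannier1941]

TWO-LAYER PLAN. Foreseen glued split of WeakCouplingLatticeGap (k = 3 children, depth 1), to be
filed by `route edit --split` once the level-k
vocabulary (Definition requests D1–D2) has landed and the two modular cruxes filed informal right
after open are typed:
WeakCouplingLatticeGap ⇐ ModularSelfDuality → NoSelfDualMasslessBand → UniformGapBelowFold →
WeakCouplingLatticeGap, where
(i) ModularSelfDuality (filed now, informal, rank 4) = card K1: for every modular datum C (first
instance SU(2)_k) and every L, the
level-C Hamiltonian/transfer matrix H_C(λ_E, λ_B) — Walker–Wang plaquette term with magnetic weight
function, Verlinde electric term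
(S_{fa}/S_{0a}) on edge labels, point-split cubic torus (ℤ/L)³, string-net subspace — is unitarily
equivalent to H_C(λ_B, λ_E)
(Dittrich's S-Fourier transform between the 1-skeleton and dual-1-skeleton bases); (ii)
NoSelfDualMasslessBand (filed now, informal,
rank 5) = card K2: for C = SU(2)_k, k ≥ k₀ (then SU(N)_k, (g,k)), at λ_E = λ_B the model has a
volume-uniform gap above at most two
S-exchanged ground states — no self-dual massless band; (iii) UniformGapBelowFold (NOT filed now) =
card K3 + the k → ∞ glue:
∃β₁ ∀β ≥ β₁ ∃Δ(β) > 0 ∃k₀ ∀k ≥ k₀ ∀L, the level-k transfer matrix at the Wilson image point (τ =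
λ_E/λ_B = 2(k+2)²/(π²β²)) has
spectral gap ≥ Δ(β) on (ℤ/L)³, and T_k(β) → T_Wilson(β) strongly on finite spin networks, so the gap
passes to Wilson's transfer matrix
and, through the tree's clustering ⇔ gap dictionary (timeClustering_iff_massGap,
latticeClustering_iff_gap), to WeakCouplingLatticeGap.
The glue ModularSelfDuality → NoSelfDualMasslessBand → UniformGapBelowFold → WeakCouplingLatticeGap
is provable from (iii) alone;
(i) and (ii) are load-bearing for the PROOF of (iii) (corners are dual images; the fold is not
critical). GapToContinuum is not split
here (owned by the continuum cards).

KILL CRITERIA. ModularSelfDuality refuted at the smallest non-abelian level — exact diagonalisation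
of the SU(2)₂ = Ising-category model on the
2×2×2 / 2×2×3 tori showing bulk spectra of H(λ_E, λ_B) and H(λ_B, λ_E) that differ beyond
ground-sector bookkeeping — kills the
fold: close `refuted:ModularSelfDuality` (the typed frame (L), (C) is then a generic lattice-gap
frame and should be superseded by
whichever route owns (L) next). NoSelfDualMasslessBand refuted — a self-dual massless band opening
at some k_c and persisting, the
SU(2)_k analogue of ℤ_N, N ≥ 5 — closes the route `refuted:NoSelfDualMasslessBand`; the witness is a
candidate exotic S-dual gapless
4D phase and goes to the negatives index. WeakCouplingLatticeGap refuted (a weak-coupling massless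
phase of a 4D simple-G lattice
theory) refutes the lattice half of Clay for that G — every lattice route dies with it. (L) proved
elsewhere moots the modular
children (route superseded but ModularSelfDuality keeps independent interest); (C) is shared and
closes with the continuum routes.

NOT DECOMPOSED YET. UniformGapBelowFold (layer 2, above) and everything inside it: the
electric-corner polymer expansion of the level-k model for
τ ≥ C(k+2)² (card P1; the non-monotone Verlinde weights 2cos(π(2j+1)/(k+2)) flagged by the novelty
audit), Bravyi–Hastings–Michalakis /
Michalakis–Zwolak stability of the commuting-projector Crane–Yetter corner for τ ≤ c/(k+2)² (tree
HasLTQO, HasLocalGap), the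
von Keyserlingk–Burnell–Simon confinement criterion as algebra (card P3), the monotonicity-in-τ /
sharpness statement that would let
duality PIN the unique transition at the fold (the only foreseen handle on the interior 1 < τ < Ck²,
where the Wilson image point
sits), the anomaly/SPT refinement of NoSelfDualMasslessBand (simple-current spin h = k/4: crossover
allowed vs first order forced),
the Hamiltonian ℤ_N self-duality on (ℤ/L)³ sector by sector (card P2; needs a lattice-gauge
Hamiltonian the tree lacks), and any
decomposition of GapToContinuum (owned by the continuum cards). Constants (β_sd(k), k₀(β), Δ(β) ~
e^{−cβ}, the O(1) convention factor
in β_sd) are deliberately not fixed at open.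

CHEAPEST FALSIFIER. ModularSelfDuality at k = 2: exact diagonalisation of the Ising-category
(SU(2)₂: labels {0, ½, 1}, d = (1, √2, 1)) Walker–Wang +
Verlinde-field Hamiltonian on the 2×2×2 and 2×2×3 cubic tori with point-split vertices — spec H(λ_E,
λ_B) must equal spec H(λ_B, λ_E)
up to the known ground-sector bookkeeping (k = 1 / semion already passes thermodynamically by BvKS +
ℤ₂ duality; the ℤ₂ Euclidean
shadow is the support item). A few hundred lines of kit code (WW plaquette operators with Ising
F-symbols); NOT run in this unit (no
level-k code or vocabulary here) — the first thing for a refuter to run. Lookups already run by the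
novelty audit: Oeckl–Pfeiffer
arXiv:hep-th/0008095, arXiv:hep-th/0110259 (KW dual of group-valued LGT = spin foam over Rep G, not
self-dual) and Dittrich
arXiv:1701.02037 (kinematic S-duality, no dynamics): ModularSelfDuality is not yet a citation. For
(L) itself there is no cheap
falsifier; the U(1) sanity test passes by construction (IsCompactSimpleLieGroup excludes it; for
U(1)_k the fold provably sits in
the Coulomb band, arXiv:1303.0851 §3.3, arXiv:1405.2988).

NUMBERS. β_sd(k) = 4(k+2)/(π√2) × (O(1) convention factor) ≈ 2.7, 3.6, 5.4, 9.0, 10.8, 19.8, 46.8,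
91.8 for k = 1, 2, 4, 8, 10, 20, 50, 100
(card, Kogut–Susskind normalisation of arXiv:2304.02527, β = 4/g²); electric gap of the Verlinde
term 2cos(π/(k+2)) − 2cos(2π/(k+2)) =
3π²/(k+2)² + O(k⁻⁴) (k = 10: 0.1998 vs 0.2056; k = 50: 0.0109 vs 0.0110); Wilson image point τ(β, k)
= 2(k+2)²/(π²β²) → ∞ at fixed
β; ℤ_N calibration: the Coulomb band around the self-dual point opens at N = 5
(doi:10.1103/physrevd.19.3698, doi:10.1103/physrevd.21.1013,
doi:10.1103/physrevd.20.1915); ℤ₂ self-dual point β_c = ½ log(1+√2) = 0.4407 (support item);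
strong-coupling clustering radius β₀(G, ρ, 4)
of OsterwalderSeilerAnnPhys1978 Thm 3.5 (tree fact osterwalder_seiler_torusClustering, PROVED).
Items at open: 5 typed (Target,
WeakCouplingLatticeGap, GapToContinuum, Z2FreeEnergySelfDuality, Assembly) + 2 informal cruxes filed
right after open
(ModularSelfDuality rank 4, NoSelfDualMasslessBand rank 5) = 7; cruxes = 4. Rev 2 (cone repair
2026-08-15): Z2FreeEnergySelfDuality dropped in favour of Z2TorusFreeEnergySelfDuality
(stmt-QuantumFields-9638) and the route imports cleared — the route file now imports only the
Statement, so its project cone is the Statement's own (29 modules; none of the 16 flagged unproved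
facts); items still 7, cruxes 4.

DEFINITION REQUESTS. D1 (`--kind definition`, topic Literature/RepresentationTheory): `SU2LevelKData
k` behind a general interface `ModularDatum` (finite
label type with unit, fusion multiplicities N, quantum dimensions d, S- and T-matrices, F-symbols
(6j) and R-symbols, with unitarity
of S, S² = charge conjugation, Verlinde, pentagon and hexagon stated as fields of the interface and
PROVED for the instance): the
recoupling theory of SU(2)_k at q = e^{iπ/(k+2)} — labels Fin (k+1), truncated fusion rule, d_a =
[a+1]_q, S_ab = √(2/(k+2))
sin(π(a+1)(b+1)/(k+2)), q-6j symbols in Kauffman–Lins / Kirillov–Reshetikhin closed form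
(Kauffman–Lins, Temperley–Lieb Recoupling
Theory, AM-134, found by galaxy search). D2 (`--kind definition`, topic
Literature/MathematicalPhysics/QuantumLattice):
`walkerWangHamiltonian C L wM wE` — the 3+1D Walker–Wang model of a (pre)modular datum C on the
point-split cubic torus (ℤ/L)³
(arXiv:1104.2632; explicit plaquette term arXiv:1208.5128 App. A) with a magnetic weight function wM
on plaquette labels and the Verlinde
electric term on edge labels (arXiv:1303.0851 §3), as an `Interaction (TorusSite 3 L × κ) q` so that
HasLTQO / HasLocalGap /
Matrix.HasClusterGap and FinDimSpectrum apply, plus its Euclidean-time transfer-matrix variant. Both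
are filed `--for` ModularSelfDuality
right after open. Cite facts wanted once D1–D2 exist (not filed now): the von
Keyserlingk–Burnell–Simon criterion "bulk label i
deconfined iff row i of S is degenerate" and the unique frustration-free ground state on closed
3-manifolds for modular input
(arXiv:1208.5128 §6.2–6.3); Crane–Yetter of a modular category is invertible (arXiv:hep-th/9409167);
the abelian thermodynamic identity
WW(ℤ_p^{(q)}) + Verlinde field = ℤ_p gauge theory (arXiv:1303.0851 §3.3 and App.).

Novelty: Searches (2026-08-15, this unit): `lit galaxy search "Crane-Yetter" --star all` (12 rows:
Kauffman–Lins AM-134 [explicit SU(2)_k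
recoupling, source for D1], Simon "Topological Quantum", Kirillov–Tham arXiv:2002.08571 (4D TQFT via
factorization homology), Pfeiffer
arXiv:gr-qc/0211106, and Bochniak–Hadasz–Ruba arXiv:2010.00888, read pp. 1–3: a DYNAMICAL
generalisation of Yetter's 4D TQFT for FINITE
crossed modules that reduces to finite-group lattice Yang–Mills — the group-like (symmetric) version
of "TQFT corner + coupling", i.e.
the freezing side of Deligne's dichotomy, no duality); `lit galaxy search "Walker-Wang" --star all`
(10 rows, same set as the card:
axion WW arXiv:1405.2988, invertible phases arXiv:2106.10703, QCA review; none on Yang–Mills or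
S-duality dynamics);
`lit galaxy search "q-deformed Kogut-Susskind" --star all` (0) and `"quantum group lattice gauge
theory" --star all` (0);
`lit search --hybrid "self-dual lattice gauge theory four dimensions modular tensor category
Walker-Wang confinement"` (10 held books,
generic LGT texts — Creutz 2022, the Rebbi reprint volume, Makeenko 2023 — ℤ₂/ℤ_N duality only);
crossref lookups: Wegner 1971
doi:10.1063/1.1665530, Balian–Drouffe–Itzykson 1975 doi:10.1103/physrevd.11.2098, Ukawa–Windey–Guth
1980 doi:10.1103/physrevd.21.1013,
Koide–Nagoya–Yamaguchi 2021 doi:10.1093/ptep/ptab145 (Kramers–Wannier duality DEFECTS of 4D ℤ₂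
lattice gauge theory at the self-dual
point — abelian; supports the fold trichotomy); openalex / s2 /  [refs: 10.1063/1.1665530, 10.1103/physrevd.11.2098, 10.1103/physrevd.21.1013, 10.1093/ptep/ptab145, 10.1007/jhep05(2017, 2002.08571, gr-qc/0211106, 2010.00888, 1405.2988, 2106.10703, 1609.00124, 1208.5128, 1303.0851, 2304.02527, hep-th/0106029, hep-th/0110259, 1701.02037, 2305.05950, 2306.12324, hep-th/0008095, doi:10.1063/1.1665530, doi:10.1103/physrevd.11.2098, doi:10.1103/physrevd.21.1013, doi:10.1093]

Barriers (technique_class: modular-truncation, KW-self-duality, TQO-stability): - technique_class: modular-truncation, KW-self-duality, TQO-stability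
- Literature.Barriers.QuantumFields.ZnHiggsPhaseD4: evaded — the barrier (DiscreteSubgroupFreezing)
kills FIXED FINITE SUBGROUPS, whose action gap freezes them into a Higgs corner at large β
(ZnHiggsPhaseD4.not_znTracksU1MassGapD4); modular truncations also freeze, but into the invertible
Crane–Yetter phase (unique vacuum, all bulk lines confined, arXiv:1208.5128 §6), and by Deligne
symmetric (group-like) truncations are the only other finite option; moreover no fixed level is used
along β → ∞: k ≥ k₀(β) is taken first (UniformGapBelowFold), the order of limits the barrier
demands.
- Literature.Barriers.QuantumFields.AbelianDeconfinementD4: respected, not evaded — (L) quantifies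
over compact SIMPLE G (IsCompactSimpleLieGroup excludes U(1) and every group with a torus factor);
for U(1)_k the same fold provably lies in the Coulomb band (arXiv:1303.0851 §3.3), so the line is
group-sensitive through NoSelfDualMasslessBand, a statement false for U(1)_k; GroupBlindClusteringD4
/ GroupBlindAreaLawD4 are not instantiated by any item.
- Literature.Barriers.QuantumFields.MigdalKadanoffGroupBlindness: not met — no approximate
real-space recursion is used; the k-dependence enters through the exact modular data (S, F of
C(g,k)) and the U(1) member of the family behaves differently by theorem, not by truncation error.
- Literature.Barriers.QuantumFields.PerturbativeInvisibility: conceded — no expansion in g is used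
anywh

Novelty grade: new-combination — ROUTE REVIEW rreview-0815T13-5 + rreview-0815T13-6-g2 (refuters, 2026-08-15). Grade INHERITED from the card audit of modular-selfdual-fold (new-combination: Dittrich 2017 S-Fourier dual bases + vKBS confined CY corner ⊕ q-deformed KS regularisation ⊕ ℤ_N KW fold/trichotomy; not re-audited). REVIEW:  (refuter refuter-rreview-0815T13-6-g2-0, 2026-08-15T14:49:56Z; prior: arXiv:1701.02037 (Dittrich 2017), arXiv:1208.5128 (von Keyserlingk–Burnell–Simon 2013), arXiv:1303.0851 (Burnell–vK–Simon 2013), doi:10.1063/1.1665530 (Wegner 1971), doi:10.1103/physrevd.11.2098 (BDI 1975), doi:10.1103/physrevd.21.1013 (Ukawa–Windey–Guth 1980), doi:10.1093/ptep/ptab145, arXiv:2304.02527)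

History (route lifecycle, newest last):
- 2026-08-15T13:52:46Z · rev 1: restated Target (stmt-QuantumFields-8900) — restate Target: expand decl references into the two crux bodies (open-time render blocked it: decls referenced before they landed) (planner-plancard-QuantumFields-YangMills-modu-cfb08567-0)
- 2026-08-15T16:09:17Z · rev 2: dropped Z2FreeEnergySelfDuality — cone repair (gen 2, unit rrepair-QuantumFields-ModularSelfDualF-e7deba55-g2): (1) drop the superseded support item Z2FreeEnergySelfDuality (stmt-QuantumFields-8 (planner-rrepair-QuantumFields-ModularSelfDualF-e7deba55-g2-0)
- 2026-08-16T17:35:39Z · rev 4: restated GapToContinuum (stmt-QuantumFields-8902) — route-repair (statement-revised p116790, unit rrepair-QuantumFields-ModularSelfDualF-b45e68e6): `def YangMills` gained the conjunct `sch.HasWeakCouplingLimit`; (planner-rrepair-QuantumFields-ModularSelfDualF-b45e68e6-0)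
- 2026-08-16T17:41:46Z · rev 5: restated Target (stmt-QuantumFields-9216) — route-repair (statement-revised p116790) step 2/2: restate the target X = WeakCouplingLatticeGap ∧ GapToContinuum 1:1 so its written-out second conjunct is the (planner-rrepair-QuantumFields-ModularSelfDualF-b45e68e6-0)
- 2026-08-23T07:16:59Z · DORMANT — reconciler: no traction for 6 d (last activity statement-grounded at 2026-08-17T07:22:32Z); parked, not closed — `ledger route dormant route-QuantumFields-Modul (operator:999:2295361)
- 2026-08-28T21:20:54Z · REACTIVATED — reconciler: reactivated — activity statement-closed at 2026-08-28T18:51:42Z after parking at 2026-08-23T07:16:59Z (operator:999:2784783)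
- 2026-09-03T09:43:11Z · DORMANT — reconciler: no traction for 5 d (last activity statement-checked at 2026-08-29T08:51:46Z); parked, not closed — `ledger route dormant route-QuantumFields-Modula (operator:999:3935703)

sub-problem: YangMills · status: dormant · opened planner-plancard-QuantumFields-YangMills-modu-cfb08567-0 2026-08-15T13:41:54Z · rev 5 · ledger route-QuantumFields-ModularSelfDualFold
GENERATED by the gate from the ledger (D-0016/17). Provers cite these decls: `theorem foo : Summit.QuantumFields.YangMills.Theses.ModularSelfDualFold.<Decl> := …` in Summits/QuantumFields/YangMills/Theorems/<Name>.lean.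
-/

namespace Summit.QuantumFields.YangMills.Theses.ModularSelfDualFold

open scoped BigOperators Topology Manifold Classical MeasureTheory ProbabilityTheory Matrix InnerProductSpace ComplexConjugate ContinuousMap
open Filter Set Function TopologicalSpace MeasureTheory

attribute [summit_statement] _root_.YangMills

-- earlier Target (stmt-QuantumFields-8900, replaced 2026-08-15T13:52:46Z -> stmt-QuantumFields-9216): retired by None — WeakCouplingLatticeGap ∧ GapToContinuum
-- earlier Target (stmt-QuantumFields-9216, replaced 2026-08-16T17:41:46Z -> stmt-QuantumFields-16112): retired by None — (∀ (G : Type) [Group G] [TopologicalSpace G] [IsTopologicalGroup G] [CompactSpace G] [MeasurableSpace G] [BorelSpace G], Literature.MathematicalPhysics.QuantumFieldTheory.IsCompactSimpleLieGroup G → ∀ r : Literature.MathematicalPhysics.QuantumFieldTheory.LatticeRep G, ∃ (β₁ : ℝ) (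
/-- item stmt-QuantumFields-16112 · target · rank 0 · open · by planner
why it might fail: (L) is the 4D weak-coupling lattice mass-gap problem (nothing rigorous excludes a non-abelian Coulomb phase); (C) carries asymptotic scaling along β_k → ∞ and non-triviality of the continuum limit; the modular engine ModularSelfDuality may already fail at k = 2 under exact diagonalisation.
sources: arXiv:1803.01950, JaffeWitten2000, arXiv:1701.02037, arXiv:1303.0851
[target] X = WeakCouplingLatticeGap ∧ GapToContinuum (repaired 2026-08-16: the (C) conjunct now
delivers a weak-coupling scheme, sch.HasWeakCouplingLimit, matching the re-typed `YangMills`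
p116790), written out as the explicit conjunction of the two crux bodies; why it might fail: (L) is
the 4D weak-coupling lattice mass-gap problem, (C) carries asymptotic scaling (β_k → ∞ with a_k
matched to the correlation length) and non-triviality, and the modular engine ModularSelfDuality may
already fail at k = 2 under exact diagonalisation. -/
@[route_item "route-QuantumFields-ModularSelfDualFold"]
def Target : Prop :=
  (∀ (G : Type) [Group G] [TopologicalSpace G] [IsTopologicalGroup G] [CompactSpace G] [MeasurableSpace G] [BorelSpace G], Literature.MathematicalPhysics.QuantumFieldTheory.IsCompactSimpleLieGroup G → ∀ r : Literature.MathematicalPhysics.QuantumFieldTheory.LatticeRep G, ∃ (β₁ : ℝ) (m : ℝ → ℝ), (∀ β : ℝ, β₁ ≤ β → 0 < m β) ∧ ∀ A B : Literature.MathematicalPhysics.QuantumFieldTheory.YMSpecies G, ∃ (C : ℝ) (S₀ : ℕ), ∀ β : ℝ, β₁ ≤ β → ∀ S : ℕ, S₀ ≤ S → ∀ n : ℕ, n ≤ S → |Literature.MathematicalPhysics.QuantumFieldTheory.latticeConnectedCorr r.ρ β (2 * S + 1) A.F B.F n| ≤ C * Real.exp (-(m β * n))) ∧ (∀ (G : Type)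 [Group G] [TopologicalSpace G] [IsTopologicalGroup G] [CompactSpace G] [MeasurableSpace G] [BorelSpace G], Literature.MathematicalPhysics.QuantumFieldTheory.IsCompactSimpleLieGroup G → ∀ r : Literature.MathematicalPhysics.QuantumFieldTheory.LatticeRep G, (∃ (β₁ : ℝ) (m : ℝ → ℝ), (∀ β : ℝ, β₁ ≤ β → 0 < m β) ∧ ∀ A B : Literature.MathematicalPhysics.QuantumFieldTheory.YMSpecies G, ∃ (C : ℝ) (S₀ : ℕ), ∀ β : ℝ, β₁ ≤ β → ∀ S : ℕ, S₀ ≤ S → ∀ n : ℕ, n ≤ S → |Literature.MathematicalPhysics.QuantumFieldTheory.latticeConnectedCorr r.ρ β (2 * S + 1) A.F B.F n| ≤ C * Real.exp (-(m β * n))) → ∃ (sch : Literature.MathematicalPhysics.QuantumFieldTheory.SpeciesScheme (Literature.MathematicalPhysics.QuantumFieldTheory.YMSpecies G)) (T : Literature.MathematicalPhysics.QuantumFieldTheory.OSData (Literature.MathematicalPhysics.QuantumFieldTheory.YMSpecies G) 4), sch.HasWeakCouplingLimit ∧ Literature.MathematicalPhysics.QuantumFieldTheory.IsYangMillsFor r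 sch T ∧ T.IsNontrivial r.curvature ∧ T.IsNonGaussian r.curvature ∧ ∃ Δ > 0, T.HasMassGap Δ ∧ Literature.MathematicalPhysics.QuantumFieldTheory.HasLatticeMassGap r sch Δ)

/-- item stmt-QuantumFields-8901 · crux · rank 2 · open · by planner
why it might fail: It is Chatterjee's Problem 5.1 at large β: a weak-coupling massless phase of 4D SU(N) is excluded only by numerics; the fold relocates the hard region (1 < τ < Ck², ξ ~ e^{cβ}) rather than shrinking it; C uniform in β and S needs locality, not only a gap.
sources: arXiv:1803.01950, arXiv:2006.16229, OsterwalderSeilerAnnPhys1978, arXiv:1303.0851, doi:10.1103/physrevd.21.1013, arXiv:2304.02527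
[crux] (L), card K3's k → ∞ output and the parent of the foreseen modular split: for every compact
simple G (IsCompactSimpleLieGroup) and every r : LatticeRep G there are β₁ and a rate function m
with m(β) > 0 for β ≥ β₁ such that for all gauge-invariant local lattice observables A, B (YMSpecies
G) there are C and S₀ with |latticeConnectedCorr r.ρ β (2S+1) A B n| ≤ C·exp(−m(β)·n) for all β ≥
β₁, all torus half-sides S ≥ S₀ and all time separations n ≤ S — Wilson's 4D theory is massive at
every large bare coupling, uniformly in the volume, with a prefactor uniform in β (the shape
HasLatticeMassGap demands along any scheme β_k → ∞). [difficulty: open-problem] -/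
@[route_item "route-QuantumFields-ModularSelfDualFold"]
def WeakCouplingLatticeGap : Prop :=
  ∀ (G : Type) [Group G] [TopologicalSpace G] [IsTopologicalGroup G] [CompactSpace G] [MeasurableSpace G] [BorelSpace G], Literature.MathematicalPhysics.QuantumFieldTheory.IsCompactSimpleLieGroup G → ∀ r : Literature.MathematicalPhysics.QuantumFieldTheory.LatticeRep G, ∃ (β₁ : ℝ) (m : ℝ → ℝ), (∀ β : ℝ, β₁ ≤ β → 0 < m β) ∧ ∀ A B : Literature.MathematicalPhysics.QuantumFieldTheory.YMSpecies G, ∃ (C : ℝ) (S₀ : ℕ), ∀ β : ℝ, β₁ ≤ β → ∀ S : ℕ, S₀ ≤ S → ∀ n : ℕ, n ≤ S → |Literature.MathematicalPhysics.QuantumFieldTheory.latticeConnectedCorr r.ρ β (2 * S + 1) A.F B.F n| ≤ C * Real.exp (-(m β * n))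

-- earlier GapToContinuum (stmt-QuantumFields-8902, replaced 2026-08-16T17:35:39Z -> stmt-QuantumFields-15914): retired by None — ∀ (G : Type) [Group G] [TopologicalSpace G] [IsTopologicalGroup G] [CompactSpace G] [MeasurableSpace G] [BorelSpace G], Literature.MathematicalPhysics.QuantumFieldTheory.IsCompactSimpleLieGroup G → ∀ r : Literature.MathematicalPhysics.QuantumFieldTheory.LatticeRep G, (∃ (β
/-- item stmt-QuantumFields-15914 · crux · rank 3 · open · by planner
why it might fail: Lattice massiveness carries no scale: the weak-coupling scheme needs β_k → ∞ with a_k ≍ 1/ξ(β_k) (asymptotic scaling), m(β_k) ≳ Δ·a_k uniformly and a non-Gaussian limit, else ultralocality/triviality (FixedCouplingUltralocality); no 4D construction with non-trivial Wilson loops exists yet.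
sources: Balaban1987RG1, Balaban1989LargeFieldII, MagnenRivasseauSeneor1993, arXiv:1803.01950, JaffeWitten2000
[crux] (C), the imported continuum complement, pointwise in (G, r) — RESTATED 2026-08-16 for the
Statement re-type p116790 (the ∃-conclusion gains `sch.HasWeakCouplingLimit`): for every compact
simple G and every r : LatticeRep G, IF Wilson's theory clusters exponentially at every β ≥ β₁ with
rate m(β) > 0, volume-uniformly with β-uniform prefactors (the conclusion of ThinEdgeExclusion, =
ModularSelfDualFold.WeakCouplingLatticeGap), THEN there are a sequential WEAK-COUPLING scheme sch
(a_k → 0, a_k L_k → ∞, β_k = 2/g₀(a_k)² → ∞: the continuum limit is taken at the asymptotically free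
Gaussian ultraviolet point with a_k locked to the lattice mass, a_k ≍ 1/ξ(β_k) — never at fixed or
bounded β, which FixedCouplingUltralocality kills anyway) and OS data T for all gauge-invariant
species with sch.HasWeakCouplingLimit ∧ IsYangMillsFor r sch T, T non-trivial and non-Gaussian in
r.curvature, and Δ > 0 with T.HasMassGap Δ ∧ HasLatticeMassGap r sch Δ — the UV/continuum half
(uniform lattice massiveness in, Clay data out), owned by the Bałaban-RG / renormalised-trajectory
cards and attachable by their routes; ModularSelfDualFold's copy (stmt-QuantumFields-8902) needs the
identical restatement -/
@[route_item "route-QuantumFields-ModularSelfDualFold"]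
def GapToContinuum : Prop :=
  ∀ (G : Type) [Group G] [TopologicalSpace G] [IsTopologicalGroup G] [CompactSpace G] [MeasurableSpace G] [BorelSpace G], Literature.MathematicalPhysics.QuantumFieldTheory.IsCompactSimpleLieGroup G → ∀ r : Literature.MathematicalPhysics.QuantumFieldTheory.LatticeRep G, (∃ (β₁ : ℝ) (m : ℝ → ℝ), (∀ β : ℝ, β₁ ≤ β → 0 < m β) ∧ ∀ A B : Literature.MathematicalPhysics.QuantumFieldTheory.YMSpecies G, ∃ (C : ℝ) (S₀ : ℕ), ∀ β : ℝ, β₁ ≤ β → ∀ S : ℕ, S₀ ≤ S → ∀ n : ℕ, n ≤ S → |Literature.MathematicalPhysics.QuantumFieldTheory.latticeConnectedCorr r.ρ β (2 * S + 1) A.F B.F n| ≤ C * Real.exp (-(m β * n))) → ∃ (sch : Literature.MathematicalPhysics.QuantumFieldTheory.SpeciesScheme (Literature.MathematicalPhysics.QuantumFieldTheory.YMSpecies G)) (T : Literature.MathematicalPhysics.QuantumFieldTheory.OSData (Literature.MathematicalPhysics.QuantumFieldTheory.YMSpecies G) 4), sch.HasWeakCouplingLimit ∧ Literature.MathematicalPhysics.QuantumFieldTheory.IsYangMillsFor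 r sch T ∧ T.IsNontrivial r.curvature ∧ T.IsNonGaussian r.curvature ∧ ∃ Δ > 0, T.HasMassGap Δ ∧ Literature.MathematicalPhysics.QuantumFieldTheory.HasLatticeMassGap r sch Δ

-- item stmt-QuantumFields-9482 · crux · rank 4 · open · by planner — informal only, no Lean statement yet:
--   [crux] (card K1 — MODULAR KRAMERS–WANNIER SELF-DUALITY; informal until the definition requests
--   ModularDatum/SU2LevelKData and walkerWangHamiltonian land, then to be typed by set-signature and
--   installed as child 1 of the foreseen split of WeakCouplingLatticeGap.) For every modular datum C —
--   first instance C = SU(2)_k, k ≥ 1, q = e^{iπ/(k+2)} — and every L ≥ 2, let H_C(λ_E, λ_B) = −λ_B Σ_p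
--   B_p − λ_E Σ_e h_e be the 3+1D Walker–Wang Hamiltonian of C on the point-split cubic torus (ℤ/L)³
--   restricted to the vertex-constraint (string-net) subspace, with B_p the minimal (fundamental-label)
--   Walker–Wang

-- item stmt-QuantumFields-9484 · crux · rank 5 · open · by planner — informal only, no Lean statement yet:
--   [crux] (card K2 — NO SELF-DUAL MASSLESS BAND; informal until the level-k vocabulary lands; child 2
--   of the foreseen split of WeakCouplingLatticeGap.) For C = SU(2)_k and all k ≥ k₀ (then SU(N)_k and
--   general C(g,k)): at the self-dual point λ_E = λ_B of the level-C Hamiltonian H_C of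
--   ModularSelfDuality, and on a k-independent neighbourhood |log(λ_E/λ_B)| ≤ δ, the model has a
--   spectral gap γ(k) > 0 above at most two ground states (exchanged by the duality unitary), uniformly
--   in the torus size L: finite correlation length at the fold — either a unique gapped self-dual
--   vacuum, or duality spontaneousl

/-- item stmt-QuantumFields-9638 · support · rank 9 · closed · proved by Summit.QuantumFields.YangMills.Theorems.Z2SelfDuality.z2TorusFreeEnergySelfDuality_proof (prover) · by planner
[support] SUPERSEDES Z2FreeEnergySelfDuality (stmt-QuantumFields-8903), which the route holder
should `route edit --drop` together with `imports: []` (route-repair 2026-08-15, unit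
rrepair-QuantumFields-ModularSelfDualF-e7deba55: the box/znRep/freeEnergyPerSite form imports Sweep1
+ Barriers.DiscreteSubgroupFreezing and drags 12 of the route's 17 unproved cone facts in; this
torus form lives in the Statement's own import cone). Abelian Euclidean prototype of
ModularSelfDuality (level "k = 1", provable now): four-dimensional ℤ₂ lattice gauge theory — gauge
group Multiplicative (ZMod 2) with its Borel σ-algebra supplied inline exactly as the Statement does
(letI := borel _), representation z2Rep (GaugeGroups), Wilson action Σ_p (1 − σ_p), Haar = uniform —
on the periodic tori (ℤ/(L+1))⁴ is Kramers–Wannier self-dual in free-energy form: with β* = −½ log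
tanh β (sinh 2β · sinh 2β* = 1), (L+1)⁻⁴ · [log Z_{L+1}(β) − log Z_{L+1}(β*)] → 3 log(2 cosh² β) −
6β for every β > 0, Z = torusLogPartition 4 z2Rep (LatticeGaugeDLR: log of the Haar-normalised torus
partition function); both sides vanish at the self-dual point β_c = ½ log(1+√2) ≈ 0.4407. Proof
sketch: high-temperature expansion (Z(β) -/
@[route_item "route-QuantumFields-ModularSelfDualFold"]
def Z2TorusFreeEnergySelfDuality : Prop :=
  letI : MeasurableSpace (Multiplicative (ZMod 2)) := borel _; haveI : BorelSpace (Multiplicative (ZMod 2)) := ⟨rfl⟩; ∀ β : ℝ, 0 < β → Filter.Tendsto (fun L : ℕ => (((L + 1 : ℕ) : ℝ) ^ 4)⁻¹ * (Literature.MathematicalPhysics.QuantumLattice.torusLogPartition 4 Literature.MathematicalPhysics.QuantumLattice.z2Rep β (L + 1) - Literature.MathematicalPhysics.QuantumLattice.torusLogPartition 4 Literature.MathematicalPhysics.QuantumLattice.z2Rep (-(Real.log (Real.tanh β)) / 2) (L + 1))) Filter.atTop (nhds (3 * Real.log (2 * Real.cosh β ^ 2) - 6 * β))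

-- `Z2TorusFreeEnergySelfDuality` holds: proved by `Summit.QuantumFields.YangMills.Theorems.Z2SelfDuality.z2TorusFreeEnergySelfDuality_proof` (its module imports this route file, so no `_holds` link can be stated here).

/-- item stmt-QuantumFields-8904 · assembly · rank 1 · closed · proved by Summit.QuantumFields.YangMills.Theorems.modularSelfDualFold_assembly_proof (prover) · by planner
sources: JaffeWitten2000, arXiv:1803.01950
[assembly] WeakCouplingLatticeGap → GapToContinuum → YangMills (pure logic plus the borel instance). -/
@[route_item "route-QuantumFields-ModularSelfDualFold"]
def Assembly : Prop :=
  WeakCouplingLatticeGap → GapToContinuum → YangMills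

-- `Assembly` holds: proved by `Summit.QuantumFields.YangMills.Theorems.modularSelfDualFold_assembly_proof` (its module imports this route file, so no `_holds` link can be stated here).

/-! D-0027 §2.1 — DECIDING THEOREM (planner-authored via `route open/edit --closes-file`; by planner-plancard-QuantumFields-YangMills-modu-cfb08567-0 2026-08-15T13:41:54Z):
its hypotheses are this route's items and its conclusion the sub-problem Statement (glue_lint), and it elaborates with this file. -/

@[closes "route-QuantumFields-ModularSelfDualFold"] theorem closes : WeakCouplingLatticeGap → GapToContinuum → YangMills := by
  intro h1 h2 G _ _ _ _ hG
  letI : MeasurableSpace G := borel G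
  haveI : BorelSpace G := ⟨rfl⟩
  obtain ⟨r⟩ := hG.2
  exact ⟨r, h2 G hG r (h1 G hG r)⟩

end Summit.QuantumFields.YangMills.Theses.ModularSelfDualFold
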